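import Mathlib
import Literature.LinearAlgebra.Matrix.InverseMMatrixProofs
import HarnessLib

/-!
# Entrywise monotonicity of inverses of principal submatrices of an inverse M-matrix

Helper for route `PrecisionLaplacian`, item `PrecisionIsLaplacian` (stmt-CriticalPhenomena-4803) of
`CriticalPhenomena/Ising3DConformalLimit`.

For an inverse M-matrix `U` (entrywise `≥ 0`, nonsingular, `U⁻¹` a Z-matrix;
`Literature.LinearAlgebra.Matrix.IsInverseMMatrix`) and a principal submatrix `U_J = U.submatrix f f`
(`f : m ↪ n`), the inverse of the submatrix is entrywise dominated by the corresponding block of the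
inverse: `(U_J)⁻¹ i j ≤ U⁻¹ (f i) (f j)`. This is the iterated bordering formula (2.6) of
Dellacherie–Martínez–San Martín (LNM 2118, Lemma 2.32): removing one index `k`,
`(U_{I∖{k}})⁻¹ i j = U⁻¹ i j − U⁻¹ i k · U⁻¹ k j / U⁻¹ k k ≤ U⁻¹ i j` because `U⁻¹ i k, U⁻¹ k j ≤ 0`
and `U⁻¹ k k > 0`; the general case is a strong induction on `|I|` exactly as in
`Literature.LinearAlgebra.Matrix.principalSubmatrix_closure_holds`.

For the route this is the monotonicity "−(G_A)⁻¹(0,y) ↓ and (G_A)⁻¹(0,0) ↑ in A" of the rows of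
the inverse Gram matrices of the critical two-point function.
-/

namespace Summit.CriticalPhenomena.Ising3DConformalLimit.Theorems

open scoped Matrix
open Literature.LinearAlgebra.Matrix

/-- **Iterated bordering (DMS 2014, Lemma 2.32, eq. (2.6)).** For an inverse M-matrix `U` and an
embedding `f : m ↪ n`, the inverse of the principal submatrix `U.submatrix f f` is entrywise at most
the corresponding block of `U⁻¹`: `(U.submatrix f f)⁻¹ i j ≤ U⁻¹ (f i) (f j)`. -/
theorem inv_submatrix_apply_le_inv_apply :
    ∀ (n m : Type) [Fintype n] [DecidableEq n] [Fintype m] [DecidableEq m]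
      (U : Matrix n n ℝ) (f : m ↪ n), IsInverseMMatrix U →
        ∀ i j : m, (U.submatrix f f)⁻¹ i j ≤ U⁻¹ (f i) (f j) := by
  suffices h : ∀ (N : ℕ) (n m : Type) [Fintype n] [DecidableEq n] [Fintype m] [DecidableEq m]
      (U : Matrix n n ℝ) (f : m ↪ n), Fintype.card n = N → IsInverseMMatrix U →
        ∀ i j : m, (U.submatrix f f)⁻¹ i j ≤ U⁻¹ (f i) (f j) by
    intro n m _ _ _ _ U f hU
    exact h _ n m U f rfl hU
  intro N
  induction N using Nat.strong_induction_on with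
  | _ N ih =>
    intro n m _ _ _ _ U f hN hU i j
    by_cases hf : Function.Surjective f
    · -- `f` is a bijection: reindexing.
      let e : m ≃ n := Equiv.ofBijective f ⟨f.injective, hf⟩
      have hfe : U.submatrix f f = U.submatrix e e := rfl
      rw [hfe, Matrix.inv_submatrix_equiv, Matrix.submatrix_apply]
      exact le_rfl
    · -- `f` misses an index `k`: factor through `{i // i ≠ k}` and use the one-index step.
      obtain ⟨k, hk⟩ : ∃ k, ∀ s, f s ≠ k := by simpa [Function.Surjective] using hf
      let f' : m ↪ {i : n // i ≠ k} :=
        ⟨fun s => ⟨f s, hk s⟩, fun a b h => f.injective (congrArg Subtype.val h)⟩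
      have hff' : U.submatrix f f
          = (U.submatrix (Subtype.val : {i : n // i ≠ k} → n) Subtype.val).submatrix f' f' :=
        rfl
      have hcard : Fintype.card {i : n // i ≠ k} < N :=
        hN ▸ Fintype.card_subtype_lt (p := fun i : n => i ≠ k) (x := k) (fun h => h rfl)
      have IH := ih _ hcard {i : n // i ≠ k} m
        (U.submatrix (Subtype.val : {i : n // i ≠ k} → n) Subtype.val) f' rfl (hU.submatrix_ne k)
        i j
      rw [hff']
      refine IH.trans ?_
      -- one-index step: `(U_{I∖{k}})⁻¹ i j = U⁻¹ i j − U⁻¹ i k · U⁻¹ k j / U⁻¹ k k ≤ U⁻¹ i j`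
      rw [hU.inv_submatrix_ne_apply k (f' i) (f' j)]
      have hθ := hU.inv_diag_pos k
      have h1 : U⁻¹ (f i) k ≤ 0 := hU.2.2 _ _ (hk i)
      have h2 : U⁻¹ k (f j) ≤ 0 := hU.2.2 _ _ (Ne.symm (hk j))
      have h3 : 0 ≤ U⁻¹ (f i) k * U⁻¹ k (f j) / U⁻¹ k k :=
        div_nonneg (mul_nonneg_of_nonpos_of_nonpos h1 h2) hθ.le
      show U⁻¹ (f i) (f j) - U⁻¹ (f i) k * U⁻¹ k (f j) / U⁻¹ k k ≤ U⁻¹ (f i) (f j)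
      linarith

end Summit.CriticalPhenomena.Ising3DConformalLimit.Theorems
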